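import Mathlib
import Summits.Ventures.PercRepro2.BHKEvents
import Summits.Ventures.PercRepro2.BHKMixedAnti

/-!
# Row 2′C1 in the regime `P(Q, b ∈ C₂) ≤ P(Q, b ∈ C₁)`, and the `min` form
(blind cell PercRepro2, p2 g28)

Row 2′C1 (p1 g14, conjecture of record of 2026-08-25T04:52Z): with `Q = {a₁ ↮ a₂}`, `C₁ = C(a₁)`,
`C₂ = C(a₂)` and `U = C₁ ∪ C₂`,

  **(c1)**  `P(Q) · P(Q, o ∈ U, b ∈ U) ≥ P(Q, b ∈ C₂) · P(Q, o ∈ U)`,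

and its mirror (c1m) with `P(Q, o ∈ C₂) · P(Q, b ∈ U)`.  This file proves the HALF of (c1) that the
two same-cluster BHK inequalities give for free:

* `c1_min`: `min (P(Q, b ∈ C₁), P(Q, b ∈ C₂)) · P(Q, o ∈ U) ≤ P(Q) · P(Q, o ∈ U, b ∈ U)`;
* `c1_of_bH_le_bL`: (c1) whenever `P(Q, b ∈ C₂) ≤ P(Q, b ∈ C₁)`;
* `c1_of_bL_le_bH`: the `C₁`-version of (c1) whenever `P(Q, b ∈ C₁) ≤ P(Q, b ∈ C₂)`;
* `c1m_min`, `c1m_of_oH_le_oL`: the mirror.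

Proof: `P(Q, o ∈ U, b ∈ U) ≥ P(Q, o ∈ C₁, b ∈ C₁) + P(Q, o ∈ C₂, b ∈ C₂)` (the two events are disjoint
on `Q`), each term is bounded below by BHK06 Thm 1.3 on its own cluster (`bhk_same_cluster_events`:
`P(Q, b ∈ C_i) · P(Q, o ∈ C_i) ≤ P(Q, o ∈ C_i, b ∈ C_i) · P(Q)`), and
`P(Q, o ∈ U) = P(Q, o ∈ C₁) + P(Q, o ∈ C₂)`.  So the CONTENT of row 2′C1 is the regime
`P(Q, b ∈ C₂) > P(Q, b ∈ C₁)` (the `max` version), which this file does not touch.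
-/

namespace Summit.Ventures.PercRepro2

namespace RowC1

section Main

variable {V : Type*} {E : Type*} [Fintype E] [DecidableEq E] [Fintype V] [DecidableEq V]
  {R : Type*} [CommRing R] [LinearOrder R] [IsStrictOrderedRing R]

omit [Fintype E] [DecidableEq E] [Fintype V] [DecidableEq V] in
/-- On `Q = {a₁ ↮ a₂}` the events `{a₁ ↔ x}` and `{a₂ ↔ x}` are disjoint. -/
lemma disjoint_conn_left_right (ends : E → Sym2 V) (a₁ a₂ x : V) (A B : Set (Config E)) :
    Disjoint (connEvent ends a₁ x ∩ A ∩ (connEvent ends a₁ a₂)ᶜ)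
      (connEvent ends a₂ x ∩ B ∩ (connEvent ends a₁ a₂)ᶜ) := by
  rw [Set.disjoint_left]
  rintro ω ⟨⟨h1, -⟩, hQ⟩ ⟨⟨h2, -⟩, -⟩
  exact hQ (conn_trans h1 (conn_symm h2))

omit [Fintype E] [DecidableEq E] [Fintype V] [DecidableEq V] in
/-- `{a₁ ↔ x} ∩ {a₂ ↔ x} ∩ Q = ∅`: the union `{x ∈ U} ∩ Q` is a disjoint union. -/
lemma disjoint_conn_left_right' (ends : E → Sym2 V) (a₁ a₂ x : V) :
    Disjoint (connEvent ends a₁ x ∩ (connEvent ends a₁ a₂)ᶜ)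
      (connEvent ends a₂ x ∩ (connEvent ends a₁ a₂)ᶜ) := by
  rw [Set.disjoint_left]
  rintro ω ⟨h1, hQ⟩ ⟨h2, -⟩
  exact hQ (conn_trans h1 (conn_symm h2))

omit [Fintype V] [DecidableEq V] [LinearOrder R] [IsStrictOrderedRing R] in
/-- `P(Q, x ∈ U) = P(Q, x ∈ C₁) + P(Q, x ∈ C₂)`. -/
lemma prob_union_inter_Q (p : E → R) (ends : E → Sym2 V) (a₁ a₂ x : V) :
    prob p ((connEvent ends a₁ x ∪ connEvent ends a₂ x) ∩ (connEvent ends a₁ a₂)ᶜ) =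
      prob p (connEvent ends a₁ x ∩ (connEvent ends a₁ a₂)ᶜ) +
        prob p (connEvent ends a₂ x ∩ (connEvent ends a₁ a₂)ᶜ) := by
  rw [Set.union_inter_distrib_right]
  exact prob_union_of_disjoint p (disjoint_conn_left_right' ends a₁ a₂ x)

/-- **BHK 1.3 on `C₁`, for the marks `b, o`**:
`P(Q, b ∈ C₁) · P(Q, o ∈ C₁) ≤ P(Q, b ∈ C₁, o ∈ C₁) · P(Q)`. -/
lemma bhk_left (p : E → R) (hp : IsProbVec p) (ends : E → Sym2 V) (a₁ a₂ o b : V) :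
    prob p (connEvent ends a₁ b ∩ (connEvent ends a₁ a₂)ᶜ) *
        prob p (connEvent ends a₁ o ∩ (connEvent ends a₁ a₂)ᶜ) ≤
      prob p (connEvent ends a₁ b ∩ connEvent ends a₁ o ∩ (connEvent ends a₁ a₂)ᶜ) *
        prob p (connEvent ends a₁ a₂)ᶜ := by
  have h := bhk_same_cluster_events p hp ends a₁ a₂
    (𝓤 := {W : Set V | b ∈ W}) (𝓥 := {W : Set V | o ∈ W})
    (fun _ _ hWW' hb => hWW' hb) (fun _ _ hWW' ho => hWW' ho)
  rwa [BHKMixedAnti.clusterInEvent_mem_eq, BHKMixedAnti.clusterInEvent_mem_eq] at h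

/-- **BHK 1.3 on `C₂`, for the marks `b, o`**:
`P(Q, b ∈ C₂) · P(Q, o ∈ C₂) ≤ P(Q, b ∈ C₂, o ∈ C₂) · P(Q)`. -/
lemma bhk_right (p : E → R) (hp : IsProbVec p) (ends : E → Sym2 V) (a₁ a₂ o b : V) :
    prob p (connEvent ends a₂ b ∩ (connEvent ends a₁ a₂)ᶜ) *
        prob p (connEvent ends a₂ o ∩ (connEvent ends a₁ a₂)ᶜ) ≤
      prob p (connEvent ends a₂ b ∩ connEvent ends a₂ o ∩ (connEvent ends a₁ a₂)ᶜ) *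
        prob p (connEvent ends a₁ a₂)ᶜ := by
  have h := bhk_same_cluster_events p hp ends a₂ a₁
    (𝓤 := {W : Set V | b ∈ W}) (𝓥 := {W : Set V | o ∈ W})
    (fun _ _ hWW' hb => hWW' hb) (fun _ _ hWW' ho => hWW' ho)
  rwa [BHKMixedAnti.clusterInEvent_mem_eq, BHKMixedAnti.clusterInEvent_mem_eq,
    connEvent_comm ends a₂ a₁] at h

omit [Fintype V] [DecidableEq V] in
/-- The two same-side events sit inside `{o ∈ U} ∩ {b ∈ U} ∩ Q` disjointly:
`P(Q, b ∈ C₁, o ∈ C₁) + P(Q, b ∈ C₂, o ∈ C₂) ≤ P(Q, o ∈ U, b ∈ U)`. -/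
lemma same_side_le (p : E → R) (hp : IsProbVec p) (ends : E → Sym2 V) (a₁ a₂ o b : V) :
    prob p (connEvent ends a₁ b ∩ connEvent ends a₁ o ∩ (connEvent ends a₁ a₂)ᶜ) +
        prob p (connEvent ends a₂ b ∩ connEvent ends a₂ o ∩ (connEvent ends a₁ a₂)ᶜ) ≤
      prob p ((connEvent ends a₁ o ∪ connEvent ends a₂ o) ∩
        (connEvent ends a₁ b ∪ connEvent ends a₂ b) ∩ (connEvent ends a₁ a₂)ᶜ) := by
  rw [← prob_union_of_disjoint p (disjoint_conn_left_right ends a₁ a₂ b _ _)]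
  refine prob_mono hp ?_
  rintro ω (⟨⟨hb, ho⟩, hQ⟩ | ⟨⟨hb, ho⟩, hQ⟩)
  · exact ⟨⟨Or.inl ho, Or.inl hb⟩, hQ⟩
  · exact ⟨⟨Or.inr ho, Or.inr hb⟩, hQ⟩

/-- **The `min` form of row 2′C1**:
`min (P(Q, b ∈ C₁), P(Q, b ∈ C₂)) · P(Q, o ∈ U) ≤ P(Q) · P(Q, o ∈ U, b ∈ U)`. -/
theorem c1_min (p : E → R) (hp : IsProbVec p) (ends : E → Sym2 V) (a₁ a₂ o b : V) :
    min (prob p (connEvent ends a₁ b ∩ (connEvent ends a₁ a₂)ᶜ))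
        (prob p (connEvent ends a₂ b ∩ (connEvent ends a₁ a₂)ᶜ)) *
      prob p ((connEvent ends a₁ o ∪ connEvent ends a₂ o) ∩ (connEvent ends a₁ a₂)ᶜ) ≤
    prob p (connEvent ends a₁ a₂)ᶜ *
      prob p ((connEvent ends a₁ o ∪ connEvent ends a₂ o) ∩
        (connEvent ends a₁ b ∪ connEvent ends a₂ b) ∩ (connEvent ends a₁ a₂)ᶜ) := by
  have hL := bhk_left p hp ends a₁ a₂ o b
  have hR := bhk_right p hp ends a₁ a₂ o b
  have hS := same_side_le p hp ends a₁ a₂ o b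
  rw [prob_union_inter_Q p ends a₁ a₂ o]
  have h0L := prob_nonneg hp (connEvent ends a₁ o ∩ (connEvent ends a₁ a₂)ᶜ)
  have h0H := prob_nonneg hp (connEvent ends a₂ o ∩ (connEvent ends a₁ a₂)ᶜ)
  have h0Q := prob_nonneg hp (connEvent ends a₁ a₂)ᶜ
  have hm1 := min_le_left (prob p (connEvent ends a₁ b ∩ (connEvent ends a₁ a₂)ᶜ))
    (prob p (connEvent ends a₂ b ∩ (connEvent ends a₁ a₂)ᶜ))
  have hm2 := min_le_right (prob p (connEvent ends a₁ b ∩ (connEvent ends a₁ a₂)ᶜ))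
    (prob p (connEvent ends a₂ b ∩ (connEvent ends a₁ a₂)ᶜ))
  calc min (prob p (connEvent ends a₁ b ∩ (connEvent ends a₁ a₂)ᶜ))
        (prob p (connEvent ends a₂ b ∩ (connEvent ends a₁ a₂)ᶜ)) *
      (prob p (connEvent ends a₁ o ∩ (connEvent ends a₁ a₂)ᶜ) +
        prob p (connEvent ends a₂ o ∩ (connEvent ends a₁ a₂)ᶜ))
      ≤ prob p (connEvent ends a₁ b ∩ (connEvent ends a₁ a₂)ᶜ) *
          prob p (connEvent ends a₁ o ∩ (connEvent ends a₁ a₂)ᶜ) +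
        prob p (connEvent ends a₂ b ∩ (connEvent ends a₁ a₂)ᶜ) *
          prob p (connEvent ends a₂ o ∩ (connEvent ends a₁ a₂)ᶜ) := by
        rw [mul_add]
        exact add_le_add (mul_le_mul_of_nonneg_right hm1 h0L) (mul_le_mul_of_nonneg_right hm2 h0H)
    _ ≤ (prob p (connEvent ends a₁ b ∩ connEvent ends a₁ o ∩ (connEvent ends a₁ a₂)ᶜ) +
          prob p (connEvent ends a₂ b ∩ connEvent ends a₂ o ∩ (connEvent ends a₁ a₂)ᶜ)) *
        prob p (connEvent ends a₁ a₂)ᶜ := by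
        rw [add_mul]
        exact add_le_add hL hR
    _ ≤ prob p ((connEvent ends a₁ o ∪ connEvent ends a₂ o) ∩
          (connEvent ends a₁ b ∪ connEvent ends a₂ b) ∩ (connEvent ends a₁ a₂)ᶜ) *
        prob p (connEvent ends a₁ a₂)ᶜ := mul_le_mul_of_nonneg_right hS h0Q
    _ = _ := mul_comm _ _

/-- **Row 2′C1 in the regime `P(Q, b ∈ C₂) ≤ P(Q, b ∈ C₁)`**:
`P(Q, b ∈ C₂) · P(Q, o ∈ U) ≤ P(Q) · P(Q, o ∈ U, b ∈ U)`. -/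
theorem c1_of_bH_le_bL (p : E → R) (hp : IsProbVec p) (ends : E → Sym2 V) (a₁ a₂ o b : V)
    (h : prob p (connEvent ends a₂ b ∩ (connEvent ends a₁ a₂)ᶜ) ≤
      prob p (connEvent ends a₁ b ∩ (connEvent ends a₁ a₂)ᶜ)) :
    prob p (connEvent ends a₂ b ∩ (connEvent ends a₁ a₂)ᶜ) *
      prob p ((connEvent ends a₁ o ∪ connEvent ends a₂ o) ∩ (connEvent ends a₁ a₂)ᶜ) ≤
    prob p (connEvent ends a₁ a₂)ᶜ *
      prob p ((connEvent ends a₁ o ∪ connEvent ends a₂ o) ∩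
        (connEvent ends a₁ b ∪ connEvent ends a₂ b) ∩ (connEvent ends a₁ a₂)ᶜ) := by
  have := c1_min p hp ends a₁ a₂ o b
  rwa [min_eq_right h] at this

/-- **The `C₁`-version of row 2′C1 in the regime `P(Q, b ∈ C₁) ≤ P(Q, b ∈ C₂)`**:
`P(Q, b ∈ C₁) · P(Q, o ∈ U) ≤ P(Q) · P(Q, o ∈ U, b ∈ U)`. -/
theorem c1_of_bL_le_bH (p : E → R) (hp : IsProbVec p) (ends : E → Sym2 V) (a₁ a₂ o b : V)
    (h : prob p (connEvent ends a₁ b ∩ (connEvent ends a₁ a₂)ᶜ) ≤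
      prob p (connEvent ends a₂ b ∩ (connEvent ends a₁ a₂)ᶜ)) :
    prob p (connEvent ends a₁ b ∩ (connEvent ends a₁ a₂)ᶜ) *
      prob p ((connEvent ends a₁ o ∪ connEvent ends a₂ o) ∩ (connEvent ends a₁ a₂)ᶜ) ≤
    prob p (connEvent ends a₁ a₂)ᶜ *
      prob p ((connEvent ends a₁ o ∪ connEvent ends a₂ o) ∩
        (connEvent ends a₁ b ∪ connEvent ends a₂ b) ∩ (connEvent ends a₁ a₂)ᶜ) := by
  have := c1_min p hp ends a₁ a₂ o b
  rwa [min_eq_left h] at this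

/-- **The mirror (c1m), `min` form**: `min (P(Q, o ∈ C₁), P(Q, o ∈ C₂)) · P(Q, b ∈ U) ≤
P(Q) · P(Q, o ∈ U, b ∈ U)` — `c1_min` with the marks `o, b` exchanged. -/
theorem c1m_min (p : E → R) (hp : IsProbVec p) (ends : E → Sym2 V) (a₁ a₂ o b : V) :
    min (prob p (connEvent ends a₁ o ∩ (connEvent ends a₁ a₂)ᶜ))
        (prob p (connEvent ends a₂ o ∩ (connEvent ends a₁ a₂)ᶜ)) *
      prob p ((connEvent ends a₁ b ∪ connEvent ends a₂ b) ∩ (connEvent ends a₁ a₂)ᶜ) ≤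
    prob p (connEvent ends a₁ a₂)ᶜ *
      prob p ((connEvent ends a₁ o ∪ connEvent ends a₂ o) ∩
        (connEvent ends a₁ b ∪ connEvent ends a₂ b) ∩ (connEvent ends a₁ a₂)ᶜ) := by
  have := c1_min p hp ends a₁ a₂ b o
  rwa [Set.inter_comm (connEvent ends a₁ b ∪ connEvent ends a₂ b)
    (connEvent ends a₁ o ∪ connEvent ends a₂ o)] at this

/-- **The mirror (c1m) in the regime `P(Q, o ∈ C₂) ≤ P(Q, o ∈ C₁)`**. -/
theorem c1m_of_oH_le_oL (p : E → R) (hp : IsProbVec p) (ends : E → Sym2 V) (a₁ a₂ o b : V)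
    (h : prob p (connEvent ends a₂ o ∩ (connEvent ends a₁ a₂)ᶜ) ≤
      prob p (connEvent ends a₁ o ∩ (connEvent ends a₁ a₂)ᶜ)) :
    prob p (connEvent ends a₂ o ∩ (connEvent ends a₁ a₂)ᶜ) *
      prob p ((connEvent ends a₁ b ∪ connEvent ends a₂ b) ∩ (connEvent ends a₁ a₂)ᶜ) ≤
    prob p (connEvent ends a₁ a₂)ᶜ *
      prob p ((connEvent ends a₁ o ∪ connEvent ends a₂ o) ∩
        (connEvent ends a₁ b ∪ connEvent ends a₂ b) ∩ (connEvent ends a₁ a₂)ᶜ) := by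
  have := c1m_min p hp ends a₁ a₂ o b
  rwa [min_eq_right h] at this

end Main

end RowC1

end Summit.Ventures.PercRepro2
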